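import Summits.Ventures.CertifiedManyBodySolver.Upper.SourcedBoxNodeOfGaugedWitness
import HarnessLib

/-!
# Lieb's partial particle–hole unitary is an involution up to a global sign; `Sᴴ X S` versus `S X Sᴴ`

HONEST FRAMING: first certified bounds; not a superconductivity verdict. Nothing here is a number or a row. The IRD desk's
node theorems (`SourcedBoxNodeOfGaugedWitness.lean`) are stated with the rows a reader evaluates, `Sᴴ A_C S` and `Sᴴ N S`
(`H̃ = Sᴴ H S` is `H` in the producers' basis `S|s⟩`), while the tree's dictionary lemmas (`partialParticleHole_conj_*`,
`orbitalPhase_conj_*`, `partialParticleHole_conj_dWaveSourceOpenBox`) are conjugations `S X Sᴴ`. This file relates the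
two: the partial particle–hole transformation `W = partialParticleHole D` satisfies `W² = w_D(D)·1` with the SIGN
`w_D(D) = ∏_{j ∈ D} (-1)^{#{l ∈ D | l < j}} = (-1)^{|D|(|D|-1)/2}`, hence `Wᴴ = w_D(D)·W` and `Wᴴ X W = W X Wᴴ` for every
`X`; for the gauged Shiba frame `S = orbitalPhase g · W` this gives `Sᴴ X S = S' X S'ᴴ` with
`S' = W · orbitalPhase (ḡ)` (conjugate phases, the primed order) — for the producers' real signs `g = ±1`, `S' = W · orbitalPhase g`.

* `phWeight_mul_phWeight_symmDiff`: `w_D(t)·w_D(t ∆ D) = w_D(D)`;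
* `partialParticleHole_mul_self`: `W * W = w_D(D) • 1`; `partialParticleHole_conjTranspose_eq_smul`: `Wᴴ = w_D(D) • W`;
* `partialParticleHole_conjTranspose_conj_eq`: `Wᴴ X W = W X Wᴴ`;
* `gaugedShiba_conjTranspose_conj_eq`: `(G W)ᴴ X (G W) = (W Ḡ) X (W Ḡ)ᴴ`, `Ḡ = orbitalPhase (star ∘ g)`.
Written by the IRD desk (sr-mbsolver-ird-5).
-/

noncomputable section
namespace Summit.Ventures.CertifiedManyBodySolver
open Matrix Finset Literature.MathematicalPhysics.QuantumLattice HubbardWave0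
open scoped symmDiff

section Involution

variable {ι : Type*} [LinearOrder ι]

/-- Splitting a weight along a subset: `w_D(t) = w_D(t \\ s) · w_D(s)` for `s ⊆ t`. [folklore] -/
theorem phWeight_eq_mul_of_subset (D : Finset ι) {s t : Finset ι} (h : s ⊆ t) :
    phWeight D t = phWeight D (t \ s) * phWeight D s := by
  rw [phWeight, phWeight, phWeight, Finset.prod_sdiff h]

/-- **`w_D(t) · w_D(t ∆ D) = w_D(D)`** for every configuration `t`: the orbitals of `t` outside `D` occur twice (their
signs square to `1`), those of `D` exactly once. [folklore] -/
theorem phWeight_mul_phWeight_symmDiff (D t : Finset ι) :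
    phWeight D t * phWeight D (t ∆ D) = phWeight D D := by
  have h1 : t ∩ D ⊆ t := Finset.inter_subset_left
  have h2 : D \ t ⊆ t ∆ D := by
    intro x hx
    rw [Finset.mem_symmDiff]; rw [Finset.mem_sdiff] at hx; tauto
  have h3 : t ∩ D ⊆ D := Finset.inter_subset_right
  have e1 : t \ (t ∩ D) = t \ D := by
    ext x; simp only [Finset.mem_sdiff, Finset.mem_inter]; tauto
  have e2 : (t ∆ D) \ (D \ t) = t \ D := by
    ext x; simp only [Finset.mem_sdiff, Finset.mem_symmDiff]; tauto
  have e3 : D \ (t ∩ D) = D \ t := by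
    ext x; simp only [Finset.mem_sdiff, Finset.mem_inter]; tauto
  rw [phWeight_eq_mul_of_subset D h1, phWeight_eq_mul_of_subset D h2, phWeight_eq_mul_of_subset D h3, e1, e2, e3]
  calc phWeight D (t \ D) * phWeight D (t ∩ D) * (phWeight D (t \ D) * phWeight D (D \ t))
      = (phWeight D (t \ D) * phWeight D (t \ D)) * (phWeight D (D \ t) * phWeight D (t ∩ D)) := by ring
    _ = phWeight D (D \ t) * phWeight D (t ∩ D) := by rw [phWeight_mul_self, one_mul]

variable [Fintype ι]

/-- **`W² = w_D(D) · 1`**: Lieb's partial particle–hole unitary is an involution up to the global sign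
`w_D(D) = (-1)^{|D|(|D|-1)/2}`. [cite: Lieb1989, proof of Theorem 2] -/
theorem partialParticleHole_mul_self (D : Finset ι) :
    partialParticleHole D * partialParticleHole D = phWeight D D • (1 : Matrix (Finset ι) (Finset ι) ℂ) := by
  apply matrix_eq_of_mulVec_eq
  intro ψ
  funext t
  rw [← mulVec_mulVec, partialParticleHole_mulVec_apply, partialParticleHole_mulVec_apply,
    Literature.MathematicalPhysics.QuantumLattice.symmDiff_symmDiff_self', Matrix.smul_mulVec, one_mulVec, Pi.smul_apply, smul_eq_mul, ← mul_assoc, mul_comm (phWeight D (t ∆ D)),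
    phWeight_mul_phWeight_symmDiff]

/-- **`Wᴴ = w_D(D) · W`.** [cite: Lieb1989, proof of Theorem 2] -/
theorem partialParticleHole_conjTranspose_eq_smul (D : Finset ι) :
    (partialParticleHole D)ᴴ = phWeight D D • partialParticleHole D := by
  symm
  calc phWeight D D • partialParticleHole D
      = phWeight D D • ((partialParticleHole D)ᴴ * partialParticleHole D * partialParticleHole D) := by
        rw [partialParticleHole_conjTranspose_mul, Matrix.one_mul]
    _ = phWeight D D • ((partialParticleHole D)ᴴ * (phWeight D D • (1 : Matrix (Finset ι) (Finset ι) ℂ))) := by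
        rw [Matrix.mul_assoc, partialParticleHole_mul_self]
    _ = (phWeight D D * phWeight D D) • (partialParticleHole D)ᴴ := by
        rw [Matrix.mul_smul, Matrix.mul_one, smul_smul]
    _ = (partialParticleHole D)ᴴ := by rw [phWeight_mul_self, one_smul]

/-- **`Wᴴ X W = W X Wᴴ`** for every operator `X`: the two conjugations by Lieb's map coincide (the sign squares away).
[cite: Lieb1989, proof of Theorem 2] -/
theorem partialParticleHole_conjTranspose_conj_eq (D : Finset ι) (X : Matrix (Finset ι) (Finset ι) ℂ) :
    (partialParticleHole D)ᴴ * X * partialParticleHole D = partialParticleHole D * X * (partialParticleHole D)ᴴ := by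
  rw [partialParticleHole_conjTranspose_eq_smul, Matrix.smul_mul, Matrix.smul_mul, Matrix.mul_smul]

end Involution

section GaugedFrame

variable {Λ : Type*} [LinearOrder Λ] [Fintype Λ]

omit [LinearOrder Λ] [Fintype Λ] in
/-- The gauge with conjugate phases is again a gauge by phases: `|star (g i)| = 1`. [folklore] -/
theorem norm_star_phase {g : Orb Λ → ℂ} (hg : ∀ i, ‖g i‖ = 1) (i : Orb Λ) : ‖(star ∘ g) i‖ = 1 := by
  rw [Function.comp_apply, Complex.star_def, Complex.norm_conj, hg i]

/-- **`Sᴴ X S = S' X S'ᴴ`** for the gauged Shiba frame `S = orbitalPhase g · W` and the primed frame with conjugate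
phases `S' = W · orbitalPhase (star ∘ g)` (`W = partialParticleHole D↓`): the rows a reader evaluates (`Sᴴ A_C S`,
FORMAT-mpsgf1) are conjugations in the tree's `U X Uᴴ` form, to which the dictionary lemmas apply. For real signs
`g = ±1` (the producers' staggered frame) `star ∘ g = g`. [cite: Lieb1989, proof of Theorem 2] -/
theorem gaugedShiba_conjTranspose_conj_eq (g : Orb Λ → ℂ) (X : Matrix (Finset (Orb Λ)) (Finset (Orb Λ)) ℂ) :
    (orbitalPhase g * partialParticleHole (spinDownOrbitals : Finset (Orb Λ)))ᴴ * X *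
        (orbitalPhase g * partialParticleHole (spinDownOrbitals : Finset (Orb Λ))) =
      partialParticleHole (spinDownOrbitals : Finset (Orb Λ)) * orbitalPhase (star ∘ g) * X *
        (partialParticleHole (spinDownOrbitals : Finset (Orb Λ)) * orbitalPhase (star ∘ g))ᴴ := by
  have hG : (orbitalPhase (star ∘ g))ᴴ = orbitalPhase g := by
    rw [conjTranspose_orbitalPhase]
    congr 1
    funext i
    simp only [Function.comp_apply, star_star]
  rw [conjTranspose_mul, conjTranspose_mul, hG, conjTranspose_orbitalPhase g]
  have key := partialParticleHole_conjTranspose_conj_eq (spinDownOrbitals : Finset (Orb Λ))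
    (orbitalPhase (star ∘ g) * X * orbitalPhase g)
  simp only [Matrix.mul_assoc] at key ⊢
  exact key

/-- The same with real signs (`star ∘ g = g`, e.g. the producers' `g(r↓) = (-1)^{x+y}`, `g(r↑) = 1`):
`Sᴴ X S = (W · orbitalPhase g) X (W · orbitalPhase g)ᴴ`. [cite: Lieb1989, proof of Theorem 2] -/
theorem gaugedShiba_conjTranspose_conj_eq_of_real {g : Orb Λ → ℂ} (hreal : ∀ i, star (g i) = g i)
    (X : Matrix (Finset (Orb Λ)) (Finset (Orb Λ)) ℂ) :
    (orbitalPhase g * partialParticleHole (spinDownOrbitals : Finset (Orb Λ)))ᴴ * X *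
        (orbitalPhase g * partialParticleHole (spinDownOrbitals : Finset (Orb Λ))) =
      partialParticleHole (spinDownOrbitals : Finset (Orb Λ)) * orbitalPhase g * X *
        (partialParticleHole (spinDownOrbitals : Finset (Orb Λ)) * orbitalPhase g)ᴴ := by
  have hg : star ∘ g = g := funext fun i => hreal i
  rw [gaugedShiba_conjTranspose_conj_eq, hg]


/-! ### Commuting the gauge past Lieb's map: `G · W = γ(D) • W · G″` -/

omit [Fintype Λ] in
/-- Splitting a phase product along a subset: `∏_{t} g = (∏_{t \\ s} g) · ∏_{s} g` for `s ⊆ t`. [folklore] -/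
theorem prod_phase_eq_mul_of_subset (g : Orb Λ → ℂ) {s t : Finset (Orb Λ)} (h : s ⊆ t) :
    (∏ i ∈ t, g i) = (∏ i ∈ t \ s, g i) * ∏ i ∈ s, g i := by
  rw [Finset.prod_sdiff h]

omit [Fintype Λ] in
/-- The phase bookkeeping behind `G · W = γ(D) • W · G″`: with `g″ = ḡ` on `D` and `g″ = g` off `D` (`|g| = 1`),
`∏_{t} g = (∏_{D} g) · ∏_{t ∆ D} g″` for every configuration `t`. [folklore] -/
theorem prod_phase_eq_prod_mul_prod_symmDiff {g : Orb Λ → ℂ} (hg : ∀ i, ‖g i‖ = 1) (D t : Finset (Orb Λ)) :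
    (∏ i ∈ t, g i) = (∏ i ∈ D, g i) * ∏ i ∈ t ∆ D, (if i ∈ D then star (g i) else g i) := by
  have hgg : ∀ i, g i * star (g i) = 1 := fun i => by
    rw [Complex.star_def, Complex.mul_conj, Complex.normSq_eq_norm_sq, hg i]; norm_num
  have h1 : t ∩ D ⊆ t := Finset.inter_subset_left
  have h2 : D \ t ⊆ t ∆ D := by
    intro x hx
    rw [Finset.mem_symmDiff]; rw [Finset.mem_sdiff] at hx; tauto
  have h3 : t ∩ D ⊆ D := Finset.inter_subset_right
  have e1 : t \ (t ∩ D) = t \ D := by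
    ext x; simp only [Finset.mem_sdiff, Finset.mem_inter]; tauto
  have e2 : (t ∆ D) \ (D \ t) = t \ D := by
    ext x; simp only [Finset.mem_sdiff, Finset.mem_symmDiff]; tauto
  have e3 : D \ (t ∩ D) = D \ t := by
    ext x; simp only [Finset.mem_sdiff, Finset.mem_inter]; tauto
  -- off `D` the modified phase is `g`, on `D` it is `ḡ`
  have p1 : (∏ i ∈ t \ D, (if i ∈ D then star (g i) else g i)) = ∏ i ∈ t \ D, g i :=
    Finset.prod_congr rfl fun i hi => by rw [if_neg (Finset.mem_sdiff.1 hi).2]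
  have p2 : (∏ i ∈ D \ t, (if i ∈ D then star (g i) else g i)) = ∏ i ∈ D \ t, star (g i) :=
    Finset.prod_congr rfl fun i hi => by rw [if_pos (Finset.mem_sdiff.1 hi).1]
  have p3 : (∏ i ∈ D \ t, g i) * ∏ i ∈ D \ t, star (g i) = 1 := by
    rw [← Finset.prod_mul_distrib]
    exact Finset.prod_eq_one fun i _ => hgg i
  rw [prod_phase_eq_mul_of_subset g h1, prod_phase_eq_mul_of_subset g h3, prod_phase_eq_mul_of_subset _ h2,
    e1, e2, e3, p1, p2]
  calc (∏ i ∈ t \ D, g i) * ∏ i ∈ t ∩ D, g i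
      = (∏ i ∈ t \ D, g i) * (∏ i ∈ t ∩ D, g i) * ((∏ i ∈ D \ t, g i) * ∏ i ∈ D \ t, star (g i)) := by
        rw [p3, mul_one]
    _ = (∏ i ∈ D \ t, g i) * (∏ i ∈ t ∩ D, g i) * ((∏ i ∈ t \ D, g i) * ∏ i ∈ D \ t, star (g i)) := by ring

/-- **Commuting a diagonal gauge past Lieb's partial particle–hole map**: for phases `|g i| = 1`,
`orbitalPhase g · W_D = (∏_{i ∈ D} g i) • (W_D · orbitalPhase g″)` with `g″ = ḡ` on `D`, `g″ = g` off `D` (a hole on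
`D` carries the conjugate phase). For a REAL sign gauge (`g = ±1`, so `g″ = g`) the two orders `G·W` and `W·G` of the
gauged Shiba frame therefore differ exactly by the global sign `∏_{i ∈ D} g i` — the precise form of the remark in
`SourcedBoxNodeOfGaugedWitness.lean`; Rayleigh quotients and `Sᴴ X S` do not see it. [cite: Lieb1989, proof of Theorem 2] -/
theorem orbitalPhase_mul_partialParticleHole {g : Orb Λ → ℂ} (hg : ∀ i, ‖g i‖ = 1) (D : Finset (Orb Λ)) :
    orbitalPhase g * partialParticleHole D =
      (∏ i ∈ D, g i) • (partialParticleHole D * orbitalPhase (fun i => if i ∈ D then star (g i) else g i)) := by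
  apply matrix_eq_of_mulVec_eq
  intro ψ
  funext t
  rw [← mulVec_mulVec, orbitalPhase, mulVec_diagonal, partialParticleHole_mulVec_apply, Matrix.smul_mulVec,
    Pi.smul_apply, ← mulVec_mulVec, partialParticleHole_mulVec_apply, orbitalPhase, mulVec_diagonal, smul_eq_mul,
    prod_phase_eq_prod_mul_prod_symmDiff hg D t]
  ring

/-- For a real sign gauge (`star (g i) = g i`, e.g. the producers' `(−1)^{x+y}` on the down orbitals):
`orbitalPhase g · W_D = (∏_{i ∈ D} g i) • (W_D · orbitalPhase g)`. [cite: Lieb1989, proof of Theorem 2] -/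
theorem orbitalPhase_mul_partialParticleHole_of_real {g : Orb Λ → ℂ} (hg : ∀ i, ‖g i‖ = 1)
    (hreal : ∀ i, star (g i) = g i) (D : Finset (Orb Λ)) :
    orbitalPhase g * partialParticleHole D = (∏ i ∈ D, g i) • (partialParticleHole D * orbitalPhase g) := by
  rw [orbitalPhase_mul_partialParticleHole hg D]
  congr 3
  funext i
  split_ifs
  · exact hreal i
  · rfl

/-- Consequently, for a real sign gauge the readers' rows do not depend on the order of the two layers:
`(G·W)ᴴ X (G·W) = (W·G)ᴴ X (W·G)` (the global sign squares away, `(∏_D g)(∏_D ḡ) = 1`).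
[cite: Lieb1989, proof of Theorem 2] -/
theorem gaugedShiba_conjTranspose_conj_eq_gaugedShiba' {g : Orb Λ → ℂ} (hg : ∀ i, ‖g i‖ = 1)
    (hreal : ∀ i, star (g i) = g i) (D : Finset (Orb Λ)) (X : Matrix (Finset (Orb Λ)) (Finset (Orb Λ)) ℂ) :
    (orbitalPhase g * partialParticleHole D)ᴴ * X * (orbitalPhase g * partialParticleHole D) =
      (partialParticleHole D * orbitalPhase g)ᴴ * X * (partialParticleHole D * orbitalPhase g) := by
  rw [orbitalPhase_mul_partialParticleHole_of_real hg hreal D, conjTranspose_smul, Matrix.smul_mul, Matrix.smul_mul,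
    Matrix.mul_smul, smul_smul, mul_comm (star (∏ i ∈ D, g i)) (∏ i ∈ D, g i), orbitalPhaseWeight_mul_star hg,
    one_smul]

end GaugedFrame
end Summit.Ventures.CertifiedManyBodySolver
end
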